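import Literature.NumberTheory.Rogawski1990.DepthZeroTransferHValuesTypeTwoChiAffine   -- ★ Chi-aff p853455 (this seat): χ₀∕χ₁ heads with the Eisenstein centre; brings ★ FILE C-aff p853441, ★ Chi, ★ FILE B
import Literature.NumberTheory.Rogawski1990.TypeTwoEisensteinData                   -- ★ F2 p852809: `det_smul_one_add_smul_fin_two`, `v_le_one_and_v_le_one_of_v_det_le_one`, `lt_one_iff_le_exp_neg_one`
import HarnessLib

/-!
# T3′'s H-side values near the identity, TYPE (2), FROM THE EISENSTEIN BLOCK (any residue characteristic):
# `Φ^st(γ_H, 1_{K_H}) = ν_H(K_H)·phiHtwo q N`, `Φ^st(γ_H, χ₀) = ν_H(K_H)·phiHtwo q (N−1)`, `Φ^st(γ_H, χ₁) = ν_H(K_H)·(phiHtwo q N − phiHtwo q (N−1))`, `N = ord_w b`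

Topic `NumberTheory/Rogawski1990`; namespace `Literature.NumberTheory.Automorphic.UnitaryGroup`.  THEOREMS ONLY (no definition, no instance, no notation, no named fact,
no `sorry`).  Cell `pub/hodgecm-mathlib`, crux H413 = `stmt-HodgeConjecture-24833`, half-A line LH4 (road M6 ∕ F5, beyond the F5 head ★ p853449
`DepthZeroKappaTransferTypeTwoGSideEisenstein`: the H-side input of the dyadic (P-2) clause, SIG-F5 v2 §3 ∕ §6.3); seat LH4-p01 (g11).  Lane `--kind proof --supports
stmt-HodgeConjecture-24833`.  HONEST LABEL: HC_CM is proved only modulo the 7 printed citations (2 remaining named inputs hLiu418 = stmt-HodgeConjecture-24832,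
h413 = stmt-HodgeConjecture-24833) until rung 0 closes; this file is unconditional, count-neutral, and reads NO hypothesis on `|2|`.

THE GLUE.  ★ FILE C-aff `DepthZeroTransferHValuesTypeTwoAffine` ∕ ★ Chi-aff `DepthZeroTransferHValuesTypeTwoChiAffine` give the type-(2) H-side values at an ADMISSIBLE
EISENSTEIN CENTRE `(a′, f, e′, j)` of `g = (γ₂)_w` (`a′ ∈ 𝒪_w`, `tr g − 2a′ = f`, `a′² − tr g·a′ + det g = −e′`, `|f| ≤ |ϖ^(j+1)|`, `|e′| = |ϖ^(2j+1)|`).  The G-side head ★ p853449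
`finsum_finExplicitDelta_mul_classOrbitalIntegral_depthZero_eq_of_eisensteinData` is stated over the EISENSTEIN BLOCK of ★ F2 `exists_eisensteinData` (`Θ`, `|det Θ| = |ϖ|`,
`|tr Θ| < 1`, `u_w•1 − g = a•1 + b•Θ`, `|b| = |ϖ|^N`), with `phiHtwo q N`, `phiHtwo q (N − 1)` in its conclusion.  §1 is the dictionary «block ⟹ centre» with radius **`j = N`**:
`a′ := u_w − a`, `f := −b·tr Θ`, `e′ := −b²·det Θ` — indeed `a′•1 − g = b•Θ`, so `tr g − 2a′ = −b·tr Θ`, `χ_g(a′) = det(b•Θ) = b²·det Θ`, `|f| = |b||tr Θ| ≤ |ϖ|^N·|ϖ|`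
(`|tr Θ| < 1 ⇒ ≤ |ϖ|`, ★ F2 `lt_one_iff_le_exp_neg_one`), `|e′| = |b|²|det Θ| = |ϖ|^(2N+1)`, and `|a′| ≤ 1` because `|a| ≤ 1` (★ F2 `v_le_one_and_v_le_one_of_v_det_le_one` on
`det(a•1 + b•Θ) = det(u_w•1 − g)`, `|det(u_w•1 − g)| ≤ 1` from `|u_w|, |tr g|, |det g| ≤ 1`).  §2 composes §1 with the ★ affine heads: the three H-side values a dyadic
(P-2) clause reads, with EXACTLY the G-side head's Eisenstein letters (`hϖ hΘd hΘt hrel hb`) + `hu : |u_w| ≤ 1` + deepness `htr hdet` (as ★ Chi ∕ the tame clause).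
At `v ∤ 2` (`Θ = ϖ^(−N)(2g − tr g)`, ★ F2 §5) these are ★ FILE C ∕ ★ Chi's values with `N` the tame radius.

* §0 `v_le_one_of_v_sub_lt_one` (`|x − c| < 1`, `|c| ≤ 1` ⇒ `|x| ≤ 1`).
* §1 `trace_sub_two_mul_eq_of_eisensteinBlock`, `eval_charpolyTwo_eq_of_eisensteinBlock` (pure algebra), `v_det_smul_one_sub_le_one`,
  **`exists_admissibleCentre_of_eisensteinBlock`** (generic `[Field K] [Valued K ℤᵐ⁰]`, ★ F2's currency).
* §2 **`stableOrbitalIntegralRel_indicator_eq_mul_phiHtwo_of_eisensteinBlock`** (`ν_H(K_H)·phiHtwo q N`), **`stableOrbitalIntegralRel_chiZero_eq_mul_phiHtwo_of_eisensteinBlock`**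
  (`ν_H(K_H)·phiHtwo q (N−1)`, `1 ≤ N`), **`stableOrbitalIntegralRel_chiOne_eq_mul_phiHtwo_sub_of_eisensteinBlock`** (`ν_H(K_H)·(phiHtwo q N − phiHtwo q (N−1))`, `1 ≤ N`).

## References
* [SerreLocalFields1979] J.-P. Serre, *Local Fields*, GTM 67 (1979): Ch. I §6 Prop. 17–18 (Eisenstein equations).
* [Flicker1998UnitaryFL] Y. Z. Flicker, *Elementary proof of the fundamental lemma for a unitary group*, Canad. J. Math. 50 (1998), §6 p. 97.
* [Rogawski1990] J. D. Rogawski, *Automorphic Representations of Unitary Groups in Three Variables* (1990), §4.9 Prop. 4.9.1 (b) p. 55, Lemma 4.9.3 p. 56; §4.3 (4.3.1) p. 43.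
* [Kottwitz1986BaseChangeUnits] R. E. Kottwitz, *Base change for unit elements of Hecke algebras*, Compositio Math. 60 (1986), §1 pp. 240–241.
-/

set_option autoImplicit false

noncomputable section

open MeasureTheory Measure Set Filter Topology NumberField IsDedekindDomain Matrix Polynomial ValuativeRel
open scoped ENNReal NNReal ValuativeRel Matrix MatrixGroups

namespace Literature.NumberTheory.Automorphic.UnitaryGroup

open Literature.NumberTheory.Rogawski1990 Literature.NumberTheory.Automorphic Literature.NumberTheory.Automorphic.IntegralReduction

/-! ## §0–§1 The admissible centre of an Eisenstein block (generic valued field) -/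

section Block

variable {K : Type*} [Field K] [Valued K (WithZero (Multiplicative ℤ))]

/-- `|x − c| < 1` and `|c| ≤ 1` imply `|x| ≤ 1`. [cite: SerreLocalFields1979, Ch. I §6] -/
theorem v_le_one_of_v_sub_lt_one {x c : K} (hc : Valued.v c ≤ 1) (h : Valued.v (x - c) < 1) : Valued.v x ≤ 1 := by
  have hx : x = (x - c) + c := by ring
  rw [hx]
  exact Valuation.map_add_le _ h.le hc

/-- **Trace of the block relation**: `u•1 − g = a•1 + b•Θ` ⇒ `tr g − 2(u − a) = −(b·tr Θ)` (`2 × 2`). [cite: SerreLocalFields1979, Ch. I §6] -/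
theorem trace_sub_two_mul_eq_of_eisensteinBlock {R : Type*} [CommRing R] {g Θ : Matrix (Fin 2) (Fin 2) R} {u a b : R}
    (hrel : u • (1 : Matrix (Fin 2) (Fin 2) R) - g = a • (1 : Matrix (Fin 2) (Fin 2) R) + b • Θ) :
    g.trace - 2 * (u - a) = -(b * Θ.trace) := by
  have h := congrArg Matrix.trace hrel
  rw [Matrix.trace_sub, Matrix.trace_add, Matrix.trace_smul, Matrix.trace_smul, Matrix.trace_smul, Matrix.trace_one, Fintype.card_fin,
    smul_eq_mul, smul_eq_mul, smul_eq_mul] at h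
  push_cast at h
  linear_combination -h

/-- **The block relation evaluates `χ_g` at the centre**: `u•1 − g = a•1 + b•Θ` ⇒ `(u − a)² − tr g·(u − a) + det g = b²·det Θ` (`χ_g(u − a) = det((u − a)•1 − g) = det(b•Θ)`).
[cite: SerreLocalFields1979, Ch. I §6] [cite: Rogawski1990, §4.9 Lemma 4.9.3 p. 56] -/
theorem eval_charpolyTwo_eq_of_eisensteinBlock {R : Type*} [CommRing R] {g Θ : Matrix (Fin 2) (Fin 2) R} {u a b : R}
    (hrel : u • (1 : Matrix (Fin 2) (Fin 2) R) - g = a • (1 : Matrix (Fin 2) (Fin 2) R) + b • Θ) :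
    (u - a) * (u - a) - g.trace * (u - a) + g.det = b ^ 2 * Θ.det := by
  have h1 : (u - a) • (1 : Matrix (Fin 2) (Fin 2) R) - g = (0 : R) • (1 : Matrix (Fin 2) (Fin 2) R) + b • Θ := by
    rw [zero_smul, zero_add, sub_smul, sub_right_comm, hrel, add_sub_cancel_left]
  have h2 : (u - a) • (1 : Matrix (Fin 2) (Fin 2) R) - g = (u - a) • (1 : Matrix (Fin 2) (Fin 2) R) + (-1 : R) • g := by
    rw [neg_one_smul, sub_eq_add_neg]
  have h3 := congrArg Matrix.det h1
  rw [h2, det_smul_one_add_smul_fin_two, det_smul_one_add_smul_fin_two] at h3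
  linear_combination h3

/-- `|u|, |tr g|, |det g| ≤ 1` ⇒ `|det(u•1 − g)| ≤ 1` (`det(u•1 − g) = u² − u·tr g + det g`). [cite: SerreLocalFields1979, Ch. I §6] -/
theorem v_det_smul_one_sub_le_one {g : Matrix (Fin 2) (Fin 2) K} {u : K} (hu : Valued.v u ≤ 1) (htr : Valued.v g.trace ≤ 1) (hdet : Valued.v g.det ≤ 1) :
    Valued.v (u • (1 : Matrix (Fin 2) (Fin 2) K) - g).det ≤ 1 := by
  have h2 : u • (1 : Matrix (Fin 2) (Fin 2) K) - g = u • (1 : Matrix (Fin 2) (Fin 2) K) + (-1 : K) • g := by rw [neg_one_smul, sub_eq_add_neg]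
  rw [h2, det_smul_one_add_smul_fin_two]
  refine Valuation.map_add_le _ (Valuation.map_add_le _ ?_ ?_) ?_
  · rw [map_pow]; exact pow_le_one₀ zero_le hu
  · rw [map_mul, map_mul, Valuation.map_neg, map_one, mul_one]; exact mul_le_one' hu htr
  · rw [map_mul, map_pow, Valuation.map_neg, map_one, one_pow, one_mul]; exact hdet

/-- **THE ADMISSIBLE CENTRE OF AN EISENSTEIN BLOCK** (★ F2's currency; radius `j := N`).  If `|det Θ| = |ϖ|`, `|tr Θ| < 1`, `u•1 − g = a•1 + b•Θ`, `|b| = |ϖ|^N`, and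
`|u|, |tr g|, |det g| ≤ 1`, then `(a′, f, e′) := (u − a, −b·tr Θ, −b²·det Θ)` is an admissible Eisenstein centre of `g` of radius `N`: `|a′| ≤ 1`, `tr g − 2a′ = f`,
`a′·a′ − tr g·a′ + det g = −e′`, `|f| ≤ |ϖ|^(N+1)`, `|e′| = |ϖ|^(2N+1)`.  (`|a| ≤ 1` by ★ F2 `v_le_one_and_v_le_one_of_v_det_le_one` on `det(a•1 + b•Θ) = det(u•1 − g)`;
`|tr Θ| ≤ |ϖ|` by ★ `lt_one_iff_le_exp_neg_one`.)  [cite: SerreLocalFields1979, Ch. I §6 Prop. 17–18] [cite: Rogawski1990, §4.9 Lemma 4.9.3 p. 56] -/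
theorem exists_admissibleCentre_of_eisensteinBlock {ϖ : K} (hϖ : Valued.v ϖ = WithZero.exp (-1 : ℤ)) {g Θ : Matrix (Fin 2) (Fin 2) K} {u a b : K}
    (hΘd : Valued.v Θ.det = Valued.v ϖ) (hΘt : Valued.v Θ.trace < 1)
    (hrel : u • (1 : Matrix (Fin 2) (Fin 2) K) - g = a • (1 : Matrix (Fin 2) (Fin 2) K) + b • Θ)
    {N : ℕ} (hb : Valued.v b = Valued.v ϖ ^ N) (hu : Valued.v u ≤ 1) (htr : Valued.v g.trace ≤ 1) (hdet : Valued.v g.det ≤ 1) :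
    ∃ a' f e' : K, Valued.v a' ≤ 1 ∧ g.trace - 2 * a' = f ∧ a' * a' - g.trace * a' + g.det = -e' ∧
      Valued.v f ≤ Valued.v ϖ ^ (N + 1) ∧ Valued.v e' = Valued.v ϖ ^ (2 * N + 1) := by
  have hΘt' : Valued.v Θ.trace ≤ Valued.v ϖ := by rw [hϖ]; exact (Literature.NumberTheory.LocalFields.lt_one_iff_le_exp_neg_one _).1 hΘt
  -- `|a| ≤ 1`: the Eisenstein integral basis read through the norm (★ F2 §1 backwards)
  have hdu : Valued.v (a • (1 : Matrix (Fin 2) (Fin 2) K) + b • Θ).det ≤ 1 := by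
    rw [← hrel]; exact v_det_smul_one_sub_le_one hu htr hdet
  obtain ⟨ha, -⟩ := v_le_one_and_v_le_one_of_v_det_le_one hϖ hΘd hΘt' hdu
  refine ⟨u - a, -(b * Θ.trace), -(b ^ 2 * Θ.det), Valuation.map_sub_le _ hu ha, trace_sub_two_mul_eq_of_eisensteinBlock hrel, ?_, ?_, ?_⟩
  · rw [neg_neg]; exact eval_charpolyTwo_eq_of_eisensteinBlock hrel
  · rw [Valuation.map_neg, map_mul, hb, pow_succ]
    exact mul_le_mul_right hΘt' _
  · rw [Valuation.map_neg, map_mul, map_pow, hb, hΘd, ← pow_mul, ← pow_succ]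
    congr 1
    ring

end Block

/-! ## §2 The three H-side values a dyadic (P-2) clause reads, over the Eisenstein block -/

section Heads

variable (L : Type) [Field L] [NumberField L] [IsCMField L] (v : HeightOneSpectrum (𝓞 ↥(maximalRealSubfield L)))
  (w : PlacesOver L v) (hw : IsCMField.complexConj L • w.1 = w.1)
  [MeasurableSpace ((cmDatum L 2 (Matrix.of fun i j : Fin 2 => if i.val + j.val + 1 = 2 then (1 : L) else 0)).Local v × (cmDatum L 1 (Matrix.of fun i j : Fin 1 => if i.val + j.val + 1 = 1 then (1 : L) else 0)).Local v)] [BorelSpace ((cmDatum L 2 (Matrix.of fun i j : Fin 2 => if i.val + j.val + 1 = 2 then (1 : L) else 0)).Local v × (cmDatum L 1 (Matrix.of fun i j : Fin 1 => if i.val + j.val + 1 = 1 then (1 : L) else 0)).Local v)]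
  [∀ a : (cmDatum L 2 (Matrix.of fun i j : Fin 2 => if i.val + j.val + 1 = 2 then (1 : L) else 0)).Local v × (cmDatum L 1 (Matrix.of fun i j : Fin 1 => if i.val + j.val + 1 = 1 then (1 : L) else 0)).Local v, MeasurableSpace (((cmDatum L 2 (Matrix.of fun i j : Fin 2 => if i.val + j.val + 1 = 2 then (1 : L) else 0)).Local v × (cmDatum L 1 (Matrix.of fun i j : Fin 1 => if i.val + j.val + 1 = 1 then (1 : L) else 0)).Local v) ⧸ Subgroup.centralizer ({a} : Set ((cmDatum L 2 (Matrix.of fun i j : Fin 2 => if i.val + j.val + 1 = 2 then (1 : L) else 0)).Local v × (cmDatum L 1 (Matrix.of fun i j : Fin 1 => if i.val + j.val + 1 = 1 then (1 : L) else 0)).Local v)))]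
  [∀ a : (cmDatum L 2 (Matrix.of fun i j : Fin 2 => if i.val + j.val + 1 = 2 then (1 : L) else 0)).Local v × (cmDatum L 1 (Matrix.of fun i j : Fin 1 => if i.val + j.val + 1 = 1 then (1 : L) else 0)).Local v, BorelSpace (((cmDatum L 2 (Matrix.of fun i j : Fin 2 => if i.val + j.val + 1 = 2 then (1 : L) else 0)).Local v × (cmDatum L 1 (Matrix.of fun i j : Fin 1 => if i.val + j.val + 1 = 1 then (1 : L) else 0)).Local v) ⧸ Subgroup.centralizer ({a} : Set ((cmDatum L 2 (Matrix.of fun i j : Fin 2 => if i.val + j.val + 1 = 2 then (1 : L) else 0)).Local v × (cmDatum L 1 (Matrix.of fun i j : Fin 1 => if i.val + j.val + 1 = 1 then (1 : L) else 0)).Local v)))]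
  (νH : Measure ((cmDatum L 2 (Matrix.of fun i j : Fin 2 => if i.val + j.val + 1 = 2 then (1 : L) else 0)).Local v × (cmDatum L 1 (Matrix.of fun i j : Fin 1 => if i.val + j.val + 1 = 1 then (1 : L) else 0)).Local v)) [νH.IsHaarMeasure] [νH.IsMulRightInvariant]

set_option maxHeartbeats 400000 in
include hw in
/-- **THE TYPE-(2) UNIT VALUE OVER THE EISENSTEIN BLOCK: `Φ^st(γ_H, 1_{K_H}) = ν_H(K_H) · phiHtwo q N`** (`N = ord_w b`), any Haar measure — ★ FILE C-aff
`stableOrbitalIntegralRel_indicator_eq_mul_phiHtwo_of_not_exists_isRoot_affine` at the centre of §1.  Binders: the G-side head's Eisenstein letters `hϖ hΘd hΘt hrel hb` (★ p853449)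
+ `hu : |u_w| ≤ 1` + `|tr g_w| ≤ 1`, `|det g_w| ≤ 1` (★ `valued_trace_le_one_and_valued_det_le_one_of_hint`).  Twin of ★ FILE C `…indicator_eq_mul_phiHtwo_of_not_exists_isRoot`
(`h2 hint N hN`). [cite: Flicker1998UnitaryFL, §6 p. 97] [cite: Rogawski1990, §4.9 Prop. 4.9.1 (b) p. 55; §4.3 (4.3.1) p. 43] -/
theorem stableOrbitalIntegralRel_indicator_eq_mul_phiHtwo_of_eisensteinBlock (hunr : Algebra.IsUnramifiedIn (𝓞 L) v.asIdeal)
    {mH : OrbitalMeasureFamily ((cmDatum L 2 (Matrix.of fun i j : Fin 2 => if i.val + j.val + 1 = 2 then (1 : L) else 0)).Local v × (cmDatum L 1 (Matrix.of fun i j : Fin 1 => if i.val + j.val + 1 = 1 then (1 : L) else 0)).Local v)} (hmH : mH.IsCanonical (IsLocalGRegular L v) νH)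
    {γH : (cmDatum L 2 (Matrix.of fun i j : Fin 2 => if i.val + j.val + 1 = 2 then (1 : L) else 0)).Local v × (cmDatum L 1 (Matrix.of fun i j : Fin 1 => if i.val + j.val + 1 = 1 then (1 : L) else 0)).Local v} (hreg : IsLocalGRegular L v γH)
    [CompactSpace (Subgroup.centralizer ({γH.1} : Set ((cmDatum L 2 (Matrix.of fun i j : Fin 2 => if i.val + j.val + 1 = 2 then (1 : L) else 0)).Local v)))]
    (hirr : ¬ ∃ x : (w.1.adicCompletion L), ((((((γH).1.val : GL (Fin 2) (UnitaryGroup.LocalRing L v)).val.map (Pi.evalRingHom (fun w' : PlacesOver L v => w'.1.adicCompletion L) w)))).charpoly).IsRoot x)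
    {ϖ : (w.1.adicCompletion L)} (hϖ : Valued.v ϖ = WithZero.exp (-1 : ℤ))
    {Θ : Matrix (Fin 2) (Fin 2) (w.1.adicCompletion L)} {a b : (w.1.adicCompletion L)}
    (hΘd : Valued.v Θ.det = Valued.v ϖ) (hΘt : Valued.v Θ.trace < 1)
    (hrel : (finGammaTwo L v γH w) • (1 : Matrix (Fin 2) (Fin 2) (w.1.adicCompletion L)) - ((((γH).1.val : GL (Fin 2) (UnitaryGroup.LocalRing L v)).val.map (Pi.evalRingHom (fun w' : PlacesOver L v => w'.1.adicCompletion L) w))) = a • (1 : Matrix (Fin 2) (Fin 2) (w.1.adicCompletion L)) + b • Θ)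
    {N : ℕ} (hb : Valued.v b = Valued.v ϖ ^ N) (hu : Valued.v (finGammaTwo L v γH w) ≤ 1)
    (htrO : Valued.v ((((γH).1.val : GL (Fin 2) (UnitaryGroup.LocalRing L v)).val.map (Pi.evalRingHom (fun w' : PlacesOver L v => w'.1.adicCompletion L) w))).trace ≤ 1) (hdetO : Valued.v ((((γH).1.val : GL (Fin 2) (UnitaryGroup.LocalRing L v)).val.map (Pi.evalRingHom (fun w' : PlacesOver L v => w'.1.adicCompletion L) w))).det ≤ 1) :
    stableOrbitalIntegralRel (IsLocalStablyConjH L v) mH (((((cmLocalIntegralLevel L 2 (Matrix.of fun i j : Fin 2 => if i.val + j.val + 1 = 2 then (1 : L) else 0) v).prod (cmLocalIntegralLevel L 1 (Matrix.of fun i j : Fin 1 => if i.val + j.val + 1 = 1 then (1 : L) else 0) v)) : Subgroup ((cmDatum L 2 (Matrix.of fun i j : Fin 2 => if i.val + j.val + 1 = 2 then (1 : L) else 0)).Local v × (cmDatum L 1 (Matrix.of fun i j : Fin 1 => if i.val + j.val + 1 = 1 then (1 : L) else 0)).Local v)) : Set ((cmDatum L 2 (Matrix.of fun i j : Fin 2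 => if i.val + j.val + 1 = 2 then (1 : L) else 0)).Local v × (cmDatum L 1 (Matrix.of fun i j : Fin 1 => if i.val + j.val + 1 = 1 then (1 : L) else 0)).Local v)).indicator fun _ => (1 : ℂ)) γH = (νH.real ((((cmLocalIntegralLevel L 2 (Matrix.of fun i j : Fin 2 => if i.val + j.val + 1 = 2 then (1 : L) else 0) v).prod (cmLocalIntegralLevel L 1 (Matrix.of fun i j : Fin 1 => if i.val + j.val + 1 = 1 then (1 : L) else 0) v)) : Subgroup ((cmDatum L 2 (Matrix.of fun i j : Fin 2 => if i.val + j.val + 1 = 2 then (1 : L) else 0)).Local v × (cmDatum L 1 (Matrix.of fun i j : Fin 1 => if i.val + j.val + 1 = 1 then (1 : L) else 0)).Local v)) : Set ((cmDatum L 2 (Matrix.of fun i j : Fin 2 => if i.val + j.val + 1 = 2 then (1 : L) else 0)).Local v × (cmDatum L 1 (Matrix.of fun i j : Fin 1 => if i.val + j.val + 1 = 1 then (1 : L) else 0)).Local v)) : ℂ) * ((Flicker1998.phiHtwo (Ideal.absNorm v.asIdeal) N : ℚ) : ℂ) := by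
  -- the admissible centre (§1) in the `ValuativeRel` currency of ★ FILE C-aff ∕ Chi-aff, radius `j := N`, uniformiser `ϖ_w := ι_w(ϖ_v)`
  have hϖ₀ := Liu2021.LemD1IndexedNonVacuityInertCofinite.valued_toPlace_uniformizer_of_isUnramifiedIn L v hunr w
  obtain ⟨a', f, e', ha', htf, hde, hf, hj⟩ := exists_admissibleCentre_of_eisensteinBlock hϖ hΘd hΘt hrel hb hu htrO hdetO
  have haO : a' ∈ 𝒪[(w.1.adicCompletion L)] := (v_le_one_iff_mem_integer a').1 ha'
  have hpow : ∀ k : ℕ, Valued.v ((toPlace v w (GaloisRepresentations.HeckeCharacter.uniformizer ↥(maximalRealSubfield L) v : v.adicCompletion ↥(maximalRealSubfield L))) ^ k) = Valued.v ϖ ^ k := fun k => by rw [map_pow, hϖ₀, hϖ]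
  have hf' : valuation (w.1.adicCompletion L) f ≤ valuation (w.1.adicCompletion L) ((toPlace v w (GaloisRepresentations.HeckeCharacter.uniformizer ↥(maximalRealSubfield L) v : v.adicCompletion ↥(maximalRealSubfield L))) ^ (N + 1)) := (v_le_iff_valuation_le _ _).1 (by rw [hpow]; exact hf)
  have hj' : valuation (w.1.adicCompletion L) e' = valuation (w.1.adicCompletion L) ((toPlace v w (GaloisRepresentations.HeckeCharacter.uniformizer ↥(maximalRealSubfield L) v : v.adicCompletion ↥(maximalRealSubfield L))) ^ (2 * N + 1)) := (v_eq_iff_valuation_eq _ _).1 (by rw [hpow]; exact hj)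
  exact stableOrbitalIntegralRel_indicator_eq_mul_phiHtwo_of_not_exists_isRoot_affine L v w hw νH hunr hmH hreg hirr haO hf' hj' htf hde

set_option maxHeartbeats 400000 in
include hw in
/-- **O8c HEAD (χ₀), TYPE (2), OVER THE EISENSTEIN BLOCK: `Φ^st(γ_H, χ₀) = ν_H(K_H) · phiHtwo q (N − 1)`** (`N = ord_w b ≥ 1`) for HEAD v4's
`χ₀ = 1_{K_H}·[(red h_{W,w} − 1)² = 0 ∧ rank(red h_{W,w} − 1) = 0]`, at a deep (`tr g_w ≡ 2`, `det g_w ≡ 1 (mod 𝔪_w)`) `G`-regular `γ_H` of type (2), `[CompactSpace Z(γ₂)]` —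
★ Chi-aff `stableOrbitalIntegralRel_chiZero_eq_mul_phiHtwo_of_not_exists_isRoot_affine` at the centre of §1.  Twin of ★ Chi `…chiZero…_of_not_exists_isRoot` (`h2 hint N hN hN1` ↦ the
Eisenstein letters of ★ p853449 + `hu`).  Decidability binder `χdec` (pass `_`). [cite: Flicker1998UnitaryFL, §6 p. 97] [cite: Rogawski1990, §4.9 Prop. 4.9.1 (b) p. 55; §4.3 (4.3.1) p. 43]
[cite: Kottwitz1986BaseChangeUnits, §1 pp. 240–241] -/
theorem stableOrbitalIntegralRel_chiZero_eq_mul_phiHtwo_of_eisensteinBlock (hunr : Algebra.IsUnramifiedIn (𝓞 L) v.asIdeal)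
    {mH : OrbitalMeasureFamily ((cmDatum L 2 (Matrix.of fun i j : Fin 2 => if i.val + j.val + 1 = 2 then (1 : L) else 0)).Local v × (cmDatum L 1 (Matrix.of fun i j : Fin 1 => if i.val + j.val + 1 = 1 then (1 : L) else 0)).Local v)} (hmH : mH.IsCanonical (IsLocalGRegular L v) νH)
    {γH : (cmDatum L 2 (Matrix.of fun i j : Fin 2 => if i.val + j.val + 1 = 2 then (1 : L) else 0)).Local v × (cmDatum L 1 (Matrix.of fun i j : Fin 1 => if i.val + j.val + 1 = 1 then (1 : L) else 0)).Local v} (hreg : IsLocalGRegular L v γH)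
    [CompactSpace (Subgroup.centralizer ({γH.1} : Set ((cmDatum L 2 (Matrix.of fun i j : Fin 2 => if i.val + j.val + 1 = 2 then (1 : L) else 0)).Local v)))]
    (hirr : ¬ ∃ x : (w.1.adicCompletion L), ((((((γH).1.val : GL (Fin 2) (UnitaryGroup.LocalRing L v)).val.map (Pi.evalRingHom (fun w' : PlacesOver L v => w'.1.adicCompletion L) w)))).charpoly).IsRoot x)
    {ϖ : (w.1.adicCompletion L)} (hϖ : Valued.v ϖ = WithZero.exp (-1 : ℤ))
    {Θ : Matrix (Fin 2) (Fin 2) (w.1.adicCompletion L)} {a b : (w.1.adicCompletion L)}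
    (hΘd : Valued.v Θ.det = Valued.v ϖ) (hΘt : Valued.v Θ.trace < 1)
    (hrel : (finGammaTwo L v γH w) • (1 : Matrix (Fin 2) (Fin 2) (w.1.adicCompletion L)) - ((((γH).1.val : GL (Fin 2) (UnitaryGroup.LocalRing L v)).val.map (Pi.evalRingHom (fun w' : PlacesOver L v => w'.1.adicCompletion L) w))) = a • (1 : Matrix (Fin 2) (Fin 2) (w.1.adicCompletion L)) + b • Θ)
    {N : ℕ} (hb : Valued.v b = Valued.v ϖ ^ N) (hu : Valued.v (finGammaTwo L v γH w) ≤ 1)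
    (hN1 : 1 ≤ N)
    (htr : Valued.v (((((γH).1.val : GL (Fin 2) (UnitaryGroup.LocalRing L v)).val.map (Pi.evalRingHom (fun w' : PlacesOver L v => w'.1.adicCompletion L) w))).trace - 2) < 1) (hdet : Valued.v (((((γH).1.val : GL (Fin 2) (UnitaryGroup.LocalRing L v)).val.map (Pi.evalRingHom (fun w' : PlacesOver L v => w'.1.adicCompletion L) w))).det - 1) < 1)
    (χdec : ∀ h : ((cmDatum L 2 (Matrix.of fun i j : Fin 2 => if i.val + j.val + 1 = 2 then (1 : L) else 0)).Local v × (cmDatum L 1 (Matrix.of fun i j : Fin 1 => if i.val + j.val + 1 = 1 then (1 : L) else 0)).Local v), Decidable ((redMat (((h).1.val : GL (Fin 2) (UnitaryGroup.LocalRing L v)).val.map (Pi.evalRingHom (fun w' : PlacesOver L v => w'.1.adicCompletion L) w)) - 1) ^ 2 = 0 ∧ (redMat (((h).1.val : GL (Fin 2) (UnitaryGroup.LocalRing L v)).val.map (Pi.evalRingHom (fun w' : PlacesOver L v => w'.1.adicCompletion L) w)) - 1).rank = 0)) :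
    stableOrbitalIntegralRel (IsLocalStablyConjH L v) mH (((((cmLocalIntegralLevel L 2 (Matrix.of fun i j : Fin 2 => if i.val + j.val + 1 = 2 then (1 : L) else 0) v).prod (cmLocalIntegralLevel L 1 (Matrix.of fun i j : Fin 1 => if i.val + j.val + 1 = 1 then (1 : L) else 0) v)) : Subgroup ((cmDatum L 2 (Matrix.of fun i j : Fin 2 => if i.val + j.val + 1 = 2 then (1 : L) else 0)).Local v × (cmDatum L 1 (Matrix.of fun i j : Fin 1 => if i.val + j.val + 1 = 1 then (1 : L) else 0)).Local v)) : Set ((cmDatum L 2 (Matrix.of fun i j : Fin 2 => if i.val + j.val + 1 = 2 then (1 : L) else 0)).Local v × (cmDatum L 1 (Matrix.of fun i j : Fin 1 => if i.val + j.val + 1 = 1 then (1 : L) else 0)).Local v)).indicator fun h => if (redMat (((h).1.val : GL (Fin 2) (UnitaryGroup.LocalRing L v)).val.map (Pi.evalRingHom (fun w' : PlacesOver L v => w'.1.adicCompletion L) w)) - 1) ^ 2 = 0 ∧ (redMat (((h).1.val : GL (Fin 2) (UnitaryGroup.LocalRing L v)).val.map (Pi.evalRingHom (fun w' : PlacesOver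 L v => w'.1.adicCompletion L) w)) - 1).rank = 0 then (1 : ℂ) else 0) γH = (νH.real ((((cmLocalIntegralLevel L 2 (Matrix.of fun i j : Fin 2 => if i.val + j.val + 1 = 2 then (1 : L) else 0) v).prod (cmLocalIntegralLevel L 1 (Matrix.of fun i j : Fin 1 => if i.val + j.val + 1 = 1 then (1 : L) else 0) v)) : Subgroup ((cmDatum L 2 (Matrix.of fun i j : Fin 2 => if i.val + j.val + 1 = 2 then (1 : L) else 0)).Local v × (cmDatum L 1 (Matrix.of fun i j : Fin 1 => if i.val + j.val + 1 = 1 then (1 : L) else 0)).Local v)) : Set ((cmDatum L 2 (Matrix.of fun i j : Fin 2 => if i.val + j.val + 1 = 2 then (1 : L) else 0)).Local v × (cmDatum L 1 (Matrix.of fun i j : Fin 1 => if i.val + j.val + 1 = 1 then (1 : L) else 0)).Local v)) : ℂ) * ((Flicker1998.phiHtwo (Ideal.absNorm v.asIdeal) (N - 1) : ℚ) : ℂ) := by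
  have htrO : Valued.v ((((γH).1.val : GL (Fin 2) (UnitaryGroup.LocalRing L v)).val.map (Pi.evalRingHom (fun w' : PlacesOver L v => w'.1.adicCompletion L) w))).trace ≤ 1 := v_le_one_of_v_sub_lt_one (by rw [show (2 : (w.1.adicCompletion L)) = 1 + 1 by norm_num]; exact Valuation.map_add_le _ (le_of_eq (map_one _)) (le_of_eq (map_one _))) htr
  have hdetO : Valued.v ((((γH).1.val : GL (Fin 2) (UnitaryGroup.LocalRing L v)).val.map (Pi.evalRingHom (fun w' : PlacesOver L v => w'.1.adicCompletion L) w))).det ≤ 1 := v_le_one_of_v_sub_lt_one (le_of_eq (map_one _)) hdet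
  -- the admissible centre (§1) in the `ValuativeRel` currency of ★ FILE C-aff ∕ Chi-aff, radius `j := N`, uniformiser `ϖ_w := ι_w(ϖ_v)`
  have hϖ₀ := Liu2021.LemD1IndexedNonVacuityInertCofinite.valued_toPlace_uniformizer_of_isUnramifiedIn L v hunr w
  obtain ⟨a', f, e', ha', htf, hde, hf, hj⟩ := exists_admissibleCentre_of_eisensteinBlock hϖ hΘd hΘt hrel hb hu htrO hdetO
  have haO : a' ∈ 𝒪[(w.1.adicCompletion L)] := (v_le_one_iff_mem_integer a').1 ha'
  have hpow : ∀ k : ℕ, Valued.v ((toPlace v w (GaloisRepresentations.HeckeCharacter.uniformizer ↥(maximalRealSubfield L) v : v.adicCompletion ↥(maximalRealSubfield L))) ^ k) = Valued.v ϖ ^ k := fun k => by rw [map_pow, hϖ₀, hϖ]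
  have hf' : valuation (w.1.adicCompletion L) f ≤ valuation (w.1.adicCompletion L) ((toPlace v w (GaloisRepresentations.HeckeCharacter.uniformizer ↥(maximalRealSubfield L) v : v.adicCompletion ↥(maximalRealSubfield L))) ^ (N + 1)) := (v_le_iff_valuation_le _ _).1 (by rw [hpow]; exact hf)
  have hj' : valuation (w.1.adicCompletion L) e' = valuation (w.1.adicCompletion L) ((toPlace v w (GaloisRepresentations.HeckeCharacter.uniformizer ↥(maximalRealSubfield L) v : v.adicCompletion ↥(maximalRealSubfield L))) ^ (2 * N + 1)) := (v_eq_iff_valuation_eq _ _).1 (by rw [hpow]; exact hj)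
  exact stableOrbitalIntegralRel_chiZero_eq_mul_phiHtwo_of_not_exists_isRoot_affine L v w hw νH hunr hmH hreg hirr haO hf' hj' htf hde hN1 htr hdet χdec

set_option maxHeartbeats 400000 in
include hw in
/-- **O8c HEAD (χ₁), TYPE (2), OVER THE EISENSTEIN BLOCK: `Φ^st(γ_H, χ₁) = ν_H(K_H) · (phiHtwo q N − phiHtwo q (N − 1))`** (`= ν_H(K_H)·q^N`; `N = ord_w b ≥ 1`) for HEAD v4's
`χ₁ = 1_{K_H}·[(red h_{W,w} − 1)² = 0 ∧ rank(red h_{W,w} − 1) = 1]`, same frame as the `χ₀` head — ★ Chi-aff `stableOrbitalIntegralRel_chiOne_eq_mul_phiHtwo_sub_of_not_exists_isRoot_affine`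
at the centre of §1.  Twin of ★ Chi `…chiOne…_of_not_exists_isRoot` (`h2 hint N hN hN1` ↦ the Eisenstein letters of ★ p853449 + `hu`).  Decidability binders `χdec₀ χdec₁`.
[cite: Flicker1998UnitaryFL, §6 p. 97] [cite: Rogawski1990, §4.9 Prop. 4.9.1 (b) p. 55; §4.3 (4.3.1) p. 43] [cite: Kottwitz1986BaseChangeUnits, §1 pp. 240–241] -/
theorem stableOrbitalIntegralRel_chiOne_eq_mul_phiHtwo_sub_of_eisensteinBlock (hunr : Algebra.IsUnramifiedIn (𝓞 L) v.asIdeal)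
    {mH : OrbitalMeasureFamily ((cmDatum L 2 (Matrix.of fun i j : Fin 2 => if i.val + j.val + 1 = 2 then (1 : L) else 0)).Local v × (cmDatum L 1 (Matrix.of fun i j : Fin 1 => if i.val + j.val + 1 = 1 then (1 : L) else 0)).Local v)} (hmH : mH.IsCanonical (IsLocalGRegular L v) νH)
    {γH : (cmDatum L 2 (Matrix.of fun i j : Fin 2 => if i.val + j.val + 1 = 2 then (1 : L) else 0)).Local v × (cmDatum L 1 (Matrix.of fun i j : Fin 1 => if i.val + j.val + 1 = 1 then (1 : L) else 0)).Local v} (hreg : IsLocalGRegular L v γH)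
    [CompactSpace (Subgroup.centralizer ({γH.1} : Set ((cmDatum L 2 (Matrix.of fun i j : Fin 2 => if i.val + j.val + 1 = 2 then (1 : L) else 0)).Local v)))]
    (hirr : ¬ ∃ x : (w.1.adicCompletion L), ((((((γH).1.val : GL (Fin 2) (UnitaryGroup.LocalRing L v)).val.map (Pi.evalRingHom (fun w' : PlacesOver L v => w'.1.adicCompletion L) w)))).charpoly).IsRoot x)
    {ϖ : (w.1.adicCompletion L)} (hϖ : Valued.v ϖ = WithZero.exp (-1 : ℤ))
    {Θ : Matrix (Fin 2) (Fin 2) (w.1.adicCompletion L)} {a b : (w.1.adicCompletion L)}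
    (hΘd : Valued.v Θ.det = Valued.v ϖ) (hΘt : Valued.v Θ.trace < 1)
    (hrel : (finGammaTwo L v γH w) • (1 : Matrix (Fin 2) (Fin 2) (w.1.adicCompletion L)) - ((((γH).1.val : GL (Fin 2) (UnitaryGroup.LocalRing L v)).val.map (Pi.evalRingHom (fun w' : PlacesOver L v => w'.1.adicCompletion L) w))) = a • (1 : Matrix (Fin 2) (Fin 2) (w.1.adicCompletion L)) + b • Θ)
    {N : ℕ} (hb : Valued.v b = Valued.v ϖ ^ N) (hu : Valued.v (finGammaTwo L v γH w) ≤ 1)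
    (hN1 : 1 ≤ N)
    (htr : Valued.v (((((γH).1.val : GL (Fin 2) (UnitaryGroup.LocalRing L v)).val.map (Pi.evalRingHom (fun w' : PlacesOver L v => w'.1.adicCompletion L) w))).trace - 2) < 1) (hdet : Valued.v (((((γH).1.val : GL (Fin 2) (UnitaryGroup.LocalRing L v)).val.map (Pi.evalRingHom (fun w' : PlacesOver L v => w'.1.adicCompletion L) w))).det - 1) < 1)
    (χdec₀ : ∀ h : ((cmDatum L 2 (Matrix.of fun i j : Fin 2 => if i.val + j.val + 1 = 2 then (1 : L) else 0)).Local v × (cmDatum L 1 (Matrix.of fun i j : Fin 1 => if i.val + j.val + 1 = 1 then (1 : L) else 0)).Local v), Decidable ((redMat (((h).1.val : GL (Fin 2) (UnitaryGroup.LocalRing L v)).val.map (Pi.evalRingHom (fun w' : PlacesOver L v => w'.1.adicCompletion L) w)) - 1) ^ 2 = 0 ∧ (redMat (((h).1.val : GL (Fin 2) (UnitaryGroup.LocalRing L v)).val.map (Pi.evalRingHom (fun w' : PlacesOver L v => w'.1.adicCompletion L) w)) - 1).rank = 0)) (χdec₁ : ∀ h : ((cmDatum L 2 (Matrix.of fun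 i j : Fin 2 => if i.val + j.val + 1 = 2 then (1 : L) else 0)).Local v × (cmDatum L 1 (Matrix.of fun i j : Fin 1 => if i.val + j.val + 1 = 1 then (1 : L) else 0)).Local v), Decidable ((redMat (((h).1.val : GL (Fin 2) (UnitaryGroup.LocalRing L v)).val.map (Pi.evalRingHom (fun w' : PlacesOver L v => w'.1.adicCompletion L) w)) - 1) ^ 2 = 0 ∧ (redMat (((h).1.val : GL (Fin 2) (UnitaryGroup.LocalRing L v)).val.map (Pi.evalRingHom (fun w' : PlacesOver L v => w'.1.adicCompletion L) w)) - 1).rank = 1)) :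
    stableOrbitalIntegralRel (IsLocalStablyConjH L v) mH (((((cmLocalIntegralLevel L 2 (Matrix.of fun i j : Fin 2 => if i.val + j.val + 1 = 2 then (1 : L) else 0) v).prod (cmLocalIntegralLevel L 1 (Matrix.of fun i j : Fin 1 => if i.val + j.val + 1 = 1 then (1 : L) else 0) v)) : Subgroup ((cmDatum L 2 (Matrix.of fun i j : Fin 2 => if i.val + j.val + 1 = 2 then (1 : L) else 0)).Local v × (cmDatum L 1 (Matrix.of fun i j : Fin 1 => if i.val + j.val + 1 = 1 then (1 : L) else 0)).Local v)) : Set ((cmDatum L 2 (Matrix.of fun i j : Fin 2 => if i.val + j.val + 1 = 2 then (1 : L) else 0)).Local v × (cmDatum L 1 (Matrix.of fun i j : Fin 1 => if i.val + j.val + 1 = 1 then (1 : L) else 0)).Local v)).indicator fun h => if (redMat (((h).1.val : GL (Fin 2) (UnitaryGroup.LocalRing L v)).val.map (Pi.evalRingHom (fun w' : PlacesOver L v => w'.1.adicCompletion L) w)) - 1) ^ 2 = 0 ∧ (redMat (((h).1.val : GL (Fin 2) (UnitaryGroup.LocalRing L v)).val.map (Pi.evalRingHom (fun w' : PlacesOver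 L v => w'.1.adicCompletion L) w)) - 1).rank = 1 then (1 : ℂ) else 0) γH = (νH.real ((((cmLocalIntegralLevel L 2 (Matrix.of fun i j : Fin 2 => if i.val + j.val + 1 = 2 then (1 : L) else 0) v).prod (cmLocalIntegralLevel L 1 (Matrix.of fun i j : Fin 1 => if i.val + j.val + 1 = 1 then (1 : L) else 0) v)) : Subgroup ((cmDatum L 2 (Matrix.of fun i j : Fin 2 => if i.val + j.val + 1 = 2 then (1 : L) else 0)).Local v × (cmDatum L 1 (Matrix.of fun i j : Fin 1 => if i.val + j.val + 1 = 1 then (1 : L) else 0)).Local v)) : Set ((cmDatum L 2 (Matrix.of fun i j : Fin 2 => if i.val + j.val + 1 = 2 then (1 : L) else 0)).Local v × (cmDatum L 1 (Matrix.of fun i j : Fin 1 => if i.val + j.val + 1 = 1 then (1 : L) else 0)).Local v)) : ℂ) * ((Flicker1998.phiHtwo (Ideal.absNorm v.asIdeal) N - Flicker1998.phiHtwo (Ideal.absNorm v.asIdeal) (N - 1) : ℚ) : ℂ) := by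
  have htrO : Valued.v ((((γH).1.val : GL (Fin 2) (UnitaryGroup.LocalRing L v)).val.map (Pi.evalRingHom (fun w' : PlacesOver L v => w'.1.adicCompletion L) w))).trace ≤ 1 := v_le_one_of_v_sub_lt_one (by rw [show (2 : (w.1.adicCompletion L)) = 1 + 1 by norm_num]; exact Valuation.map_add_le _ (le_of_eq (map_one _)) (le_of_eq (map_one _))) htr
  have hdetO : Valued.v ((((γH).1.val : GL (Fin 2) (UnitaryGroup.LocalRing L v)).val.map (Pi.evalRingHom (fun w' : PlacesOver L v => w'.1.adicCompletion L) w))).det ≤ 1 := v_le_one_of_v_sub_lt_one (le_of_eq (map_one _)) hdet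
  -- the admissible centre (§1) in the `ValuativeRel` currency of ★ FILE C-aff ∕ Chi-aff, radius `j := N`, uniformiser `ϖ_w := ι_w(ϖ_v)`
  have hϖ₀ := Liu2021.LemD1IndexedNonVacuityInertCofinite.valued_toPlace_uniformizer_of_isUnramifiedIn L v hunr w
  obtain ⟨a', f, e', ha', htf, hde, hf, hj⟩ := exists_admissibleCentre_of_eisensteinBlock hϖ hΘd hΘt hrel hb hu htrO hdetO
  have haO : a' ∈ 𝒪[(w.1.adicCompletion L)] := (v_le_one_iff_mem_integer a').1 ha'
  have hpow : ∀ k : ℕ, Valued.v ((toPlace v w (GaloisRepresentations.HeckeCharacter.uniformizer ↥(maximalRealSubfield L) v : v.adicCompletion ↥(maximalRealSubfield L))) ^ k) = Valued.v ϖ ^ k := fun k => by rw [map_pow, hϖ₀, hϖ]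
  have hf' : valuation (w.1.adicCompletion L) f ≤ valuation (w.1.adicCompletion L) ((toPlace v w (GaloisRepresentations.HeckeCharacter.uniformizer ↥(maximalRealSubfield L) v : v.adicCompletion ↥(maximalRealSubfield L))) ^ (N + 1)) := (v_le_iff_valuation_le _ _).1 (by rw [hpow]; exact hf)
  have hj' : valuation (w.1.adicCompletion L) e' = valuation (w.1.adicCompletion L) ((toPlace v w (GaloisRepresentations.HeckeCharacter.uniformizer ↥(maximalRealSubfield L) v : v.adicCompletion ↥(maximalRealSubfield L))) ^ (2 * N + 1)) := (v_eq_iff_valuation_eq _ _).1 (by rw [hpow]; exact hj)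
  exact stableOrbitalIntegralRel_chiOne_eq_mul_phiHtwo_sub_of_not_exists_isRoot_affine L v w hw νH hunr hmH hreg hirr haO hf' hj' htf hde hN1 htr hdet χdec₀ χdec₁

end Heads

end Literature.NumberTheory.Automorphic.UnitaryGroup

end
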